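import Mathlib
import HarnessLib
import Summits.NavierStokesRegularity.NavierStokesRegularity.Theorems.PoloidalWindowDoorPoloidalWindowRigidityZShockHodographSegment

/-!
# Crux K2 `PoloidalWindowRigidity` (stmt-NavierStokesRegularity-19708), line `z_shock` — NEGATIVE KERNEL BRICK 6a for the class-free
# slice Liouville `hGN`: SLICE MONOTONICITY and the LEVEL CURVES `ξ = ξ₀` of the hump two-wave map

`--supports stmt-NavierStokesRegularity-19708 --as helper` (leafhand-ns-poloidalwindowdoor-3 g34, cell decomp-ns, 2026-09-01).
Class-free, def-free; Mathlib + `…HodographSegment` (p842288) and bricks 1–3.  **No stub and no summit is closed by this file;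
Navier–Stokes regularity is NOT proved here (rung 0).**  Evidence memo `HGN-COUNTEREXAMPLE-leafhand3-g34.md` §3 (surjectivity, step 1).

For the hump Darboux–hodograph pair `(τ, ξ)` (`k = (1 − ρ tanh ρ)²`, `f = g = artanh(·/m)`, `F` its log-primitive, `𝔽` any primitive of
`F` on `(−m, m)`, `0 < m ≤ 1/2`):
* `prim_nonneg` — `0 ≤ F ≤ m` (with `…Hump.prim_le`); `prim2_bound` — `|𝔽 r − 𝔽 0| ≤ m·|r|` (mean value inequality);
* `slice_r_hasDerivAt` — for fixed `s`, `r ↦ (τ, ξ)(r, s)` has derivatives `(Z_r, −ψ²Z_r)` with `Z_r > 0`, `ψ > 0` (from `segment_point`);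
* `xi_slice_strictAnti` — `r ↦ ξ(r, s)` is strictly decreasing and continuous on `(−m, m)`;
* `xi_lower` / `xi_upper` — `ξ(r,s) ≥ −ψ·(f(r)+f(s)) − C₀`, `ξ(r,s) ≤ −ψ·(f(r)+f(s)) + C₀`, `C₀ = 4m² + 2|𝔽 0|`;
* `exists_unique_level` — ★ for every `ξ₀` and every `s ∈ (−m,m)` there is a UNIQUE `r ∈ (−m, m)` with `ξ(r, s) = ξ₀` (IVT between
  `r = m tanh(∓K)`): every level line of `ξ` is a graph over the `s`-axis.
[folklore]
-/

noncomputable section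

namespace Summit.NavierStokesRegularity.NavierStokesRegularity.Theorems.PoloidalWindowDoorPoloidalWindowRigidityZShockHodographOnto

-- the problem directory repeats the summit name (`NavierStokesRegularity/NavierStokesRegularity`)
set_option linter.dupNamespace false

open Real Set
open Summit.NavierStokesRegularity.NavierStokesRegularity.Theorems.PoloidalWindowDoorPoloidalWindowRigidityZShockHodographHump
open Summit.NavierStokesRegularity.NavierStokesRegularity.Theorems.PoloidalWindowDoorPoloidalWindowRigidityZShockHodographSegment

/-- `0 ≤ F(r)` for `|r| < m` (`(1+x)log(1+x) ≥ x`, `(1−x)log(1−x) ≥ −x`). [folklore] -/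
theorem prim_nonneg (m r : ℝ) (hm : 0 < m) (hr : |r| < m) :
    0 ≤ (m / 2 * ((1 + r / m) * Real.log (1 + r / m) + (1 - r / m) * Real.log (1 - r / m))) := by
  have hrabs := abs_lt.mp hr
  have hx1 : r / m < 1 := by rw [div_lt_one hm]; linarith
  have hx0 : -1 < r / m := by rw [lt_div_iff₀ hm]; linarith
  have ha : 0 < 1 + r / m := by linarith
  have hb : 0 < 1 - r / m := by linarith
  have h1 : r / m ≤ (1 + r / m) * Real.log (1 + r / m) := by
    have := Real.one_sub_inv_le_log_of_pos ha
    have e : (1 + r / m) * (1 - (1 + r / m)⁻¹) = r / m := by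
      rw [mul_sub, mul_one, mul_inv_cancel₀ ha.ne']; ring
    nlinarith [mul_le_mul_of_nonneg_left this ha.le]
  have h2 : -(r / m) ≤ (1 - r / m) * Real.log (1 - r / m) := by
    have := Real.one_sub_inv_le_log_of_pos hb
    have e : (1 - r / m) * (1 - (1 - r / m)⁻¹) = -(r / m) := by
      rw [mul_sub, mul_one, mul_inv_cancel₀ hb.ne']; ring
    nlinarith [mul_le_mul_of_nonneg_left this hb.le]
  have : 0 ≤ (1 + r / m) * Real.log (1 + r / m) + (1 - r / m) * Real.log (1 - r / m) := by linarith
  positivity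

/-- `|𝔽 r − 𝔽 0| ≤ m·|r|` on `(−m, m)` for any primitive `𝔽` of `F` (mean value inequality, `0 ≤ F ≤ m`). [folklore] -/
theorem prim2_bound (m : ℝ) (hm : 0 < m) (𝔽 : ℝ → ℝ)
    (h𝔽 : ∀ t, |t| < m → HasDerivAt 𝔽
      (m / 2 * ((1 + t / m) * Real.log (1 + t / m) + (1 - t / m) * Real.log (1 - t / m))) t)
    (r : ℝ) (hr : |r| < m) : |𝔽 r - 𝔽 0| ≤ m * |r| := by
  have h0 : |(0:ℝ)| < m := by simpa using hm
  have key := (convex_Ioo (-m) m).norm_image_sub_le_of_norm_hasDerivWithin_le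
    (f := 𝔽) (f' := fun t => (m / 2 * ((1 + t / m) * Real.log (1 + t / m) + (1 - t / m) * Real.log (1 - t / m)))) (C := m)
    (fun t ht => (h𝔽 t (abs_lt.mpr ⟨ht.1, ht.2⟩)).hasDerivWithinAt)
    (fun t ht => by
      have ht' : |t| < m := abs_lt.mpr ⟨ht.1, ht.2⟩
      rw [Real.norm_eq_abs, abs_le]
      exact ⟨by linarith [prim_nonneg m t hm ht'], prim_le m t hm ht'⟩)
    (show (0:ℝ) ∈ Set.Ioo (-m) m from ⟨by linarith, hm⟩) (show r ∈ Set.Ioo (-m) m from ⟨(abs_lt.mp hr).1, (abs_lt.mp hr).2⟩)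
  simpa using key

/-- **Slice derivatives in `r`** (fixed `s`): `∂_r τ = Z_r > 0`, `∂_r ξ = −ψ² Z_r` with `ψ > 0` (from `segment_point` with `Δr = 1`, `Δs = 0`).
[folklore] -/
theorem slice_r_hasDerivAt (m : ℝ) (hm : 0 < m) (hm' : m ≤ 1 / 2) (𝔽 : ℝ → ℝ)
    (h𝔽 : ∀ t, |t| < m → HasDerivAt 𝔽
      (m / 2 * ((1 + t / m) * Real.log (1 + t / m) + (1 - t / m) * Real.log (1 - t / m))) t)
    (r s : ℝ) (hr : |r| < m) (hs : |s| < m) :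
    ∃ Zr ψv : ℝ, 0 < Zr ∧ 0 < ψv ∧
      HasDerivAt (fun r' => ((Real.artanh ((r') / m) - Real.artanh ((s) / m) - Real.tanh (((r') - (s)) / 2) * ((m / 2 * ((1 + (r') / m) * Real.log (1 + (r') / m) + (1 - (r') / m) * Real.log (1 - (r') / m))) + (m / 2 * ((1 + (s) / m) * Real.log (1 + (s) / m) + (1 - (s) / m) * Real.log (1 - (s) / m))))) / (1 - ((r') - (s)) / 2 * Real.tanh (((r') - (s)) / 2)))) Zr r ∧
      HasDerivAt (fun r' => (-(1 - ((r') - (s)) / 2 * Real.tanh (((r') - (s)) / 2)) * (Real.artanh ((r') / m) + Real.artanh ((s) / m)) - ((r') - (s)) / 2 * ((m / 2 * ((1 + (r') / m) * Real.log (1 + (r') / m) + (1 - (r') / m) * Real.log (1 - (r') / m))) - (m / 2 * ((1 + (s) / m) * Real.log (1 + (s) / m) + (1 - (s) / m) * Real.log (1 - (s) / m)))) + (𝔽 (r') + 𝔽 (s)))) (-ψv ^ 2 * Zr) r := by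
  have hr' : |0 + r * 1| < m := by simpa using hr
  have hs' : |s + r * 0| < m := by simpa using hs
  obtain ⟨Zr, Zs, ψv, hZr, hZs, hψv, hτ, hξ⟩ := segment_point m hm hm' 𝔽 h𝔽 0 s 1 0 r hr' hs'
  refine ⟨Zr, ψv, hZr, hψv, ?_, ?_⟩
  · have e : (fun t' : ℝ => ((Real.artanh ((0 + t' * 1) / m) - Real.artanh ((s + t' * 0) / m) - Real.tanh (((0 + t' * 1) - (s + t' * 0)) / 2) * ((m / 2 * ((1 + (0 + t' * 1) / m) * Real.log (1 + (0 + t' * 1) / m) + (1 - (0 + t' * 1) / m) * Real.log (1 - (0 + t' * 1) / m))) + (m / 2 * ((1 + (s + t' * 0) / m) * Real.log (1 + (s + t' * 0) / m) + (1 - (s + t' * 0) / m) * Real.log (1 - (s + t' * 0) / m))))) / (1 - ((0 + t' * 1) - (s + t' * 0)) / 2 * Real.tanh (((0 + t' * 1) - (s + t' * 0)) / 2)))) = (fun r' => ((Real.artanh ((r') / m) - Real.artanh ((s) / m) - Real.tanh (((r') - (s)) / 2) * ((m / 2 * ((1 + (r') / m) * Real.log (1 + (r') / m) + (1 - (r')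 / m) * Real.log (1 - (r') / m))) + (m / 2 * ((1 + (s) / m) * Real.log (1 + (s) / m) + (1 - (s) / m) * Real.log (1 - (s) / m))))) / (1 - ((r') - (s)) / 2 * Real.tanh (((r') - (s)) / 2)))) := by
      funext t'; simp only [zero_add, mul_one, mul_zero, add_zero]
    rw [e] at hτ; simpa using hτ
  · have e : (fun t' : ℝ => (-(1 - ((0 + t' * 1) - (s + t' * 0)) / 2 * Real.tanh (((0 + t' * 1) - (s + t' * 0)) / 2)) * (Real.artanh ((0 + t' * 1) / m) + Real.artanh ((s + t' * 0) / m)) - ((0 + t' * 1) - (s + t' * 0)) / 2 * ((m / 2 * ((1 + (0 + t' * 1) / m) * Real.log (1 + (0 + t' * 1) / m) + (1 - (0 + t' * 1) / m) * Real.log (1 - (0 + t' * 1) / m))) - (m / 2 * ((1 + (s + t' * 0) / m) * Real.log (1 + (s + t' * 0) / m) + (1 - (s + t' * 0) / m) * Real.log (1 - (s + t' * 0) / m)))) + (𝔽 (0 + t' * 1) + 𝔽 (s + t' * 0)))) = (fun r' => (-(1 - ((r') - (s)) / 2 * Real.tanh (((r') - (s)) / 2)) * (Real.artanh ((r') / m)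 + Real.artanh ((s) / m)) - ((r') - (s)) / 2 * ((m / 2 * ((1 + (r') / m) * Real.log (1 + (r') / m) + (1 - (r') / m) * Real.log (1 - (r') / m))) - (m / 2 * ((1 + (s) / m) * Real.log (1 + (s) / m) + (1 - (s) / m) * Real.log (1 - (s) / m)))) + (𝔽 (r') + 𝔽 (s)))) := by
      funext t'; simp only [zero_add, mul_one, mul_zero, add_zero]
    rw [e] at hξ; simpa using hξ

/-- `ψ = 1 − ρ tanh ρ ∈ [1 − m², 1]` for `ρ = (r−s)/2`, `|r|, |s| < m ≤ 1/2`. [folklore] -/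
theorem psi_bounds (m r s : ℝ) (hm' : m ≤ 1 / 2) (hr : |r| < m) (hs : |s| < m) :
    1 - m ^ 2 ≤ 1 - (r - s) / 2 * Real.tanh ((r - s) / 2) ∧ 1 - (r - s) / 2 * Real.tanh ((r - s) / 2) ≤ 1 := by
  have h1 := abs_lt.mp hr; have h2 := abs_lt.mp hs
  have hρm : |(r - s) / 2| < m := by rw [abs_lt]; constructor <;> linarith
  have ht : |Real.tanh ((r - s) / 2)| ≤ |(r - s) / 2| := Literature.Barriers.HubbardSuperconductivity.abs_tanh_le_abs_self _
  have hprod : (r - s) / 2 * Real.tanh ((r - s) / 2) ≤ m ^ 2 := by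
    have a1 : (r - s) / 2 * Real.tanh ((r - s) / 2) ≤ |(r - s) / 2| * |Real.tanh ((r - s) / 2)| := by
      rw [← abs_mul]; exact le_abs_self _
    have a2 : |(r - s) / 2| * |Real.tanh ((r - s) / 2)| ≤ |(r - s) / 2| * |(r - s) / 2| :=
      mul_le_mul_of_nonneg_left ht (abs_nonneg _)
    have a3 : |(r - s) / 2| * |(r - s) / 2| ≤ m * m := by
      have := hρm.le; exact mul_le_mul this this (abs_nonneg _) (by linarith [abs_nonneg ((r-s)/2)])
    nlinarith
  have hnn : 0 ≤ (r - s) / 2 * Real.tanh ((r - s) / 2) := by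
    -- `ρ tanh ρ = |ρ| |tanh ρ|` has the sign of `ρ²`
    rcases le_total 0 ((r - s) / 2) with hρ | hρ
    · exact mul_nonneg hρ (tanh_nonneg_le hρ).1
    · have := (tanh_nonneg_le (neg_nonneg.mpr hρ)).1
      rw [Real.tanh_neg] at this
      nlinarith
  constructor <;> linarith

/-- **Two-sided control of `ξ` by the leading term**: `|ξ(r,s) + ψ·(artanh(r/m) + artanh(s/m))| ≤ 3m² + 2|𝔽 0|`. [folklore] -/
theorem xi_core_bound (m : ℝ) (hm : 0 < m) (𝔽 : ℝ → ℝ)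
    (h𝔽 : ∀ t, |t| < m → HasDerivAt 𝔽
      (m / 2 * ((1 + t / m) * Real.log (1 + t / m) + (1 - t / m) * Real.log (1 - t / m))) t)
    (r s : ℝ) (hr : |r| < m) (hs : |s| < m) :
    |(-(1 - ((r) - (s)) / 2 * Real.tanh (((r) - (s)) / 2)) * (Real.artanh ((r) / m) + Real.artanh ((s) / m)) - ((r) - (s)) / 2 * ((m / 2 * ((1 + (r) / m) * Real.log (1 + (r) / m) + (1 - (r) / m) * Real.log (1 - (r) / m))) - (m / 2 * ((1 + (s) / m) * Real.log (1 + (s) / m) + (1 - (s) / m) * Real.log (1 - (s) / m)))) + (𝔽 (r) + 𝔽 (s))) +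
        (1 - ((r) - (s)) / 2 * Real.tanh (((r) - (s)) / 2)) * (Real.artanh ((r) / m) + Real.artanh ((s) / m))| ≤
      3 * m ^ 2 + 2 * |𝔽 0| := by
  have h1 := abs_lt.mp hr; have h2 := abs_lt.mp hs
  have hFr0 := prim_nonneg m r hm hr; have hFr1 := prim_le m r hm hr
  have hFs0 := prim_nonneg m s hm hs; have hFs1 := prim_le m s hm hs
  have h𝔽r := prim2_bound m hm 𝔽 h𝔽 r hr
  have h𝔽s := prim2_bound m hm 𝔽 h𝔽 s hs
  have hρ : |((r) - (s)) / 2| ≤ m := by rw [abs_le]; constructor <;> linarith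
  -- the sum collapses to `−ρ(F_r − F_s) + 𝔽_r + 𝔽_s`
  have e : (-(1 - ((r) - (s)) / 2 * Real.tanh (((r) - (s)) / 2)) * (Real.artanh ((r) / m) + Real.artanh ((s) / m)) - ((r) - (s)) / 2 * ((m / 2 * ((1 + (r) / m) * Real.log (1 + (r) / m) + (1 - (r) / m) * Real.log (1 - (r) / m))) - (m / 2 * ((1 + (s) / m) * Real.log (1 + (s) / m) + (1 - (s) / m) * Real.log (1 - (s) / m)))) + (𝔽 (r) + 𝔽 (s))) +
        (1 - ((r) - (s)) / 2 * Real.tanh (((r) - (s)) / 2)) * (Real.artanh ((r) / m) + Real.artanh ((s) / m)) =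
      -(((r) - (s)) / 2) * ((m / 2 * ((1 + (r) / m) * Real.log (1 + (r) / m) + (1 - (r) / m) * Real.log (1 - (r) / m))) - (m / 2 * ((1 + (s) / m) * Real.log (1 + (s) / m) + (1 - (s) / m) * Real.log (1 - (s) / m)))) + ((𝔽 r - 𝔽 0) + (𝔽 s - 𝔽 0)) + 2 * 𝔽 0 := by ring
  rw [e]
  have hA : |-(((r) - (s)) / 2) * ((m / 2 * ((1 + (r) / m) * Real.log (1 + (r) / m) + (1 - (r) / m) * Real.log (1 - (r) / m))) - (m / 2 * ((1 + (s) / m) * Real.log (1 + (s) / m) + (1 - (s) / m) * Real.log (1 - (s) / m))))| ≤ m * m := by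
    rw [abs_mul, abs_neg]
    apply mul_le_mul hρ _ (abs_nonneg _) (by linarith)
    rw [abs_le]; constructor <;> linarith
  have hB : |(𝔽 r - 𝔽 0) + (𝔽 s - 𝔽 0)| ≤ m * m + m * m := by
    refine (abs_add_le _ _).trans (add_le_add ?_ ?_)
    · exact h𝔽r.trans (by nlinarith [abs_nonneg r, h1.1, h1.2, abs_lt.mpr h1])
    · exact h𝔽s.trans (by nlinarith [abs_nonneg s, abs_lt.mpr h2])
  have hC : |2 * 𝔽 0| = 2 * |𝔽 0| := by rw [abs_mul, abs_two]
  calc _ ≤ |-(((r) - (s)) / 2) * ((m / 2 * ((1 + (r) / m) * Real.log (1 + (r) / m) + (1 - (r) / m) * Real.log (1 - (r) / m))) - (m / 2 * ((1 + (s) / m) * Real.log (1 + (s) / m) + (1 - (s) / m) * Real.log (1 - (s) / m)))) + ((𝔽 r - 𝔽 0) + (𝔽 s - 𝔽 0))| + |2 * 𝔽 0| :=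
        abs_add_le _ _
    _ ≤ (|-(((r) - (s)) / 2) * ((m / 2 * ((1 + (r) / m) * Real.log (1 + (r) / m) + (1 - (r) / m) * Real.log (1 - (r) / m))) - (m / 2 * ((1 + (s) / m) * Real.log (1 + (s) / m) + (1 - (s) / m) * Real.log (1 - (s) / m))))| + |(𝔽 r - 𝔽 0) + (𝔽 s - 𝔽 0)|) + |2 * 𝔽 0| := by
        gcongr; exact abs_add_le _ _
    _ ≤ (m * m + (m * m + m * m)) + 2 * |𝔽 0| := by rw [hC]; gcongr
    _ = 3 * m ^ 2 + 2 * |𝔽 0| := by ring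

/-- **Strict monotonicity and continuity of the `r`-slices of `ξ`.** [folklore] -/
theorem xi_slice_strictAnti (m : ℝ) (hm : 0 < m) (hm' : m ≤ 1 / 2) (𝔽 : ℝ → ℝ)
    (h𝔽 : ∀ t, |t| < m → HasDerivAt 𝔽
      (m / 2 * ((1 + t / m) * Real.log (1 + t / m) + (1 - t / m) * Real.log (1 - t / m))) t)
    (s : ℝ) (hs : |s| < m) :
    StrictAntiOn (fun r' => (-(1 - ((r') - (s)) / 2 * Real.tanh (((r') - (s)) / 2)) * (Real.artanh ((r') / m) + Real.artanh ((s) / m)) - ((r') - (s)) / 2 * ((m / 2 * ((1 + (r') / m) * Real.log (1 + (r') / m) + (1 - (r') / m) * Real.log (1 - (r') / m))) - (m / 2 * ((1 + (s) / m) * Real.log (1 + (s) / m) + (1 - (s) / m) * Real.log (1 - (s) / m)))) + (𝔽 (r') + 𝔽 (s)))) (Set.Ioo (-m) m) ∧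
      ContinuousOn (fun r' => (-(1 - ((r') - (s)) / 2 * Real.tanh (((r') - (s)) / 2)) * (Real.artanh ((r') / m) + Real.artanh ((s) / m)) - ((r') - (s)) / 2 * ((m / 2 * ((1 + (r') / m) * Real.log (1 + (r') / m) + (1 - (r') / m) * Real.log (1 - (r') / m))) - (m / 2 * ((1 + (s) / m) * Real.log (1 + (s) / m) + (1 - (s) / m) * Real.log (1 - (s) / m)))) + (𝔽 (r') + 𝔽 (s)))) (Set.Ioo (-m) m) := by
  have hcont : ContinuousOn (fun r' => (-(1 - ((r') - (s)) / 2 * Real.tanh (((r') - (s)) / 2)) * (Real.artanh ((r') / m) + Real.artanh ((s) / m)) - ((r') - (s)) / 2 * ((m / 2 * ((1 + (r') / m) * Real.log (1 + (r') / m) + (1 - (r') / m) * Real.log (1 - (r') / m))) - (m / 2 * ((1 + (s) / m) * Real.log (1 + (s) / m) + (1 - (s) / m) * Real.log (1 - (s) / m)))) + (𝔽 (r') + 𝔽 (s)))) (Set.Ioo (-m) m) := by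
    intro r hr
    obtain ⟨Zr, ψv, -, -, -, hd⟩ := slice_r_hasDerivAt m hm hm' 𝔽 h𝔽 r s (abs_lt.mpr ⟨hr.1, hr.2⟩) hs
    exact hd.continuousAt.continuousWithinAt
  refine ⟨strictAntiOn_of_deriv_neg (convex_Ioo (-m) m) hcont fun r hr => ?_, hcont⟩
  rw [interior_Ioo] at hr
  obtain ⟨Zr, ψv, hZr, hψv, -, hd⟩ := slice_r_hasDerivAt m hm hm' 𝔽 h𝔽 r s (abs_lt.mpr ⟨hr.1, hr.2⟩) hs
  rw [hd.deriv]
  have : 0 < ψv ^ 2 * Zr := by positivity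
  linarith

/-- ★ **Every level line `ξ = ξ₀` is a graph over the `s`-axis**: for `|s| < m` there is a unique `r ∈ (−m, m)` with `ξ(r, s) = ξ₀`.
[folklore] -/
theorem exists_unique_level (m : ℝ) (hm : 0 < m) (hm' : m ≤ 1 / 2) (𝔽 : ℝ → ℝ)
    (h𝔽 : ∀ t, |t| < m → HasDerivAt 𝔽
      (m / 2 * ((1 + t / m) * Real.log (1 + t / m) + (1 - t / m) * Real.log (1 - t / m))) t)
    (ξ₀ s : ℝ) (hs : |s| < m) :
    ∃! r : ℝ, r ∈ Set.Ioo (-m) m ∧ (-(1 - ((r) - (s)) / 2 * Real.tanh (((r) - (s)) / 2)) * (Real.artanh ((r) / m) + Real.artanh ((s) / m)) - ((r) - (s)) / 2 * ((m / 2 * ((1 + (r) / m) * Real.log (1 + (r) / m) + (1 - (r) / m) * Real.log (1 - (r) / m))) - (m / 2 * ((1 + (s) / m) * Real.log (1 + (s) / m) + (1 - (s) / m) * Real.log (1 - (s) / m)))) + (𝔽 (r) + 𝔽 (s))) = ξ₀ := by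
  obtain ⟨hanti, hcont⟩ := xi_slice_strictAnti m hm hm' 𝔽 h𝔽 s hs
  have hm2 : 0 < 1 - m ^ 2 := by nlinarith
  set C₀ : ℝ := 3 * m ^ 2 + 2 * |𝔽 0| with hC₀
  set K : ℝ := |Real.artanh (s / m)| + (C₀ + |ξ₀| + 1) / (1 - m ^ 2) with hK
  have hKpos : 0 ≤ (C₀ + |ξ₀| + 1) / (1 - m ^ 2) := by positivity
  -- the two anchors `r± = ± m tanh K`
  have hanc : ∀ σ : ℝ, (σ = 1 ∨ σ = -1) → |m * Real.tanh (σ * K)| < m ∧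
      Real.artanh (m * Real.tanh (σ * K) / m) = σ * K := by
    intro σ hσ
    constructor
    · rw [abs_mul, abs_of_pos hm]
      have := Real.abs_tanh_lt_one (σ * K)
      nlinarith
    · rw [mul_div_cancel_left₀ _ hm.ne', Real.artanh_tanh]
  obtain ⟨hhi, ahi⟩ := hanc 1 (Or.inl rfl)
  obtain ⟨hlo, alo⟩ := hanc (-1) (Or.inr rfl)
  rw [one_mul] at hhi ahi
  -- values at the anchors
  have vhi : (-(1 - ((m * Real.tanh K) - (s)) / 2 * Real.tanh (((m * Real.tanh K) - (s)) / 2)) * (Real.artanh ((m * Real.tanh K) / m) + Real.artanh ((s) / m)) - ((m * Real.tanh K) - (s)) / 2 * ((m / 2 * ((1 + (m * Real.tanh K) / m) * Real.log (1 + (m * Real.tanh K) / m) + (1 - (m * Real.tanh K) / m) * Real.log (1 - (m * Real.tanh K) / m))) - (m / 2 * ((1 + (s) / m) * Real.log (1 + (s) / m) + (1 - (s) / m) * Real.log (1 - (s) / m)))) + (𝔽 (m * Real.tanh K) + 𝔽 (s))) < ξ₀ := by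
    have hb := xi_core_bound m hm 𝔽 h𝔽 (m * Real.tanh K) s hhi hs
    obtain ⟨hψ1, hψ2⟩ := psi_bounds m (m * Real.tanh K) s hm' hhi hs
    rw [ahi] at hb ⊢
    have hsum : (C₀ + |ξ₀| + 1) / (1 - m ^ 2) ≤ K + Real.artanh (s / m) := by
      have := neg_abs_le (Real.artanh (s / m)); rw [hK]; linarith
    have hsum0 : 0 ≤ K + Real.artanh (s / m) := le_trans hKpos hsum
    have hlead : (1 - m ^ 2) * (K + Real.artanh (s / m)) ≤
        (1 - (m * Real.tanh K - s) / 2 * Real.tanh ((m * Real.tanh K - s) / 2)) * (K + Real.artanh (s / m)) :=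
      mul_le_mul_of_nonneg_right hψ1 hsum0
    have hkey : C₀ + |ξ₀| + 1 ≤ (1 - m ^ 2) * (K + Real.artanh (s / m)) := by
      rw [div_le_iff₀ hm2] at hsum; linarith
    have hb' := (abs_le.mp hb).2
    have := neg_abs_le ξ₀
    have e2 : -(1 - (m * Real.tanh K - s) / 2 * Real.tanh ((m * Real.tanh K - s) / 2)) * (K + Real.artanh (s / m)) =
        -((1 - (m * Real.tanh K - s) / 2 * Real.tanh ((m * Real.tanh K - s) / 2)) * (K + Real.artanh (s / m))) := by
      ring
    linarith [e2]
  have vlo : ξ₀ < (-(1 - ((m * Real.tanh (-1 * K)) - (s)) / 2 * Real.tanh (((m * Real.tanh (-1 * K)) - (s)) / 2)) * (Real.artanh ((m * Real.tanh (-1 * K)) / m) + Real.artanh ((s) / m)) - ((m * Real.tanh (-1 * K)) - (s)) / 2 * ((m / 2 * ((1 + (m * Real.tanh (-1 * K)) / m) * Real.log (1 + (m * Real.tanh (-1 * K)) / m) + (1 - (m * Real.tanh (-1 * K)) / m) * Real.log (1 - (m * Real.tanh (-1 * K)) / m))) - (m / 2 * ((1 + (s) / m) * Real.log (1 + (s)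 / m) + (1 - (s) / m) * Real.log (1 - (s) / m)))) + (𝔽 (m * Real.tanh (-1 * K)) + 𝔽 (s))) := by
    have hb := xi_core_bound m hm 𝔽 h𝔽 (m * Real.tanh (-1 * K)) s hlo hs
    obtain ⟨hψ1, hψ2⟩ := psi_bounds m (m * Real.tanh (-1 * K)) s hm' hlo hs
    rw [alo] at hb ⊢
    have hsum : (C₀ + |ξ₀| + 1) / (1 - m ^ 2) ≤ K - Real.artanh (s / m) := by
      have := le_abs_self (Real.artanh (s / m)); rw [hK]; linarith
    have hsum0 : 0 ≤ K - Real.artanh (s / m) := le_trans hKpos hsum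
    have hlead : (1 - m ^ 2) * (K - Real.artanh (s / m)) ≤
        (1 - (m * Real.tanh (-1 * K) - s) / 2 * Real.tanh ((m * Real.tanh (-1 * K) - s) / 2)) *
          (K - Real.artanh (s / m)) :=
      mul_le_mul_of_nonneg_right hψ1 hsum0
    have hkey : C₀ + |ξ₀| + 1 ≤ (1 - m ^ 2) * (K - Real.artanh (s / m)) := by
      rw [div_le_iff₀ hm2] at hsum; linarith
    have hb' := (abs_le.mp hb).1
    have := le_abs_self ξ₀
    have e2 : -(1 - (m * Real.tanh (-1 * K) - s) / 2 * Real.tanh ((m * Real.tanh (-1 * K) - s) / 2)) *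
          (-1 * K + Real.artanh (s / m)) =
        (1 - (m * Real.tanh (-1 * K) - s) / 2 * Real.tanh ((m * Real.tanh (-1 * K) - s) / 2)) *
          (K - Real.artanh (s / m)) := by ring
    have e3 : (1 - (m * Real.tanh (-1 * K) - s) / 2 * Real.tanh ((m * Real.tanh (-1 * K) - s) / 2)) *
          (-1 * K + Real.artanh (s / m)) =
        -((1 - (m * Real.tanh (-1 * K) - s) / 2 * Real.tanh ((m * Real.tanh (-1 * K) - s) / 2)) *
          (K - Real.artanh (s / m))) := by ring
    linarith [e2, e3]
  -- IVT on the segment between the anchors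
  have hlo' := abs_lt.mp hlo; have hhi' := abs_lt.mp hhi
  have hsub : Set.uIcc (m * Real.tanh (-1 * K)) (m * Real.tanh K) ⊆ Set.Ioo (-m) m := by
    intro x hx
    rw [Set.mem_uIcc] at hx
    constructor <;> rcases hx with ⟨h1, h2⟩ | ⟨h1, h2⟩ <;> linarith
  have hcont' : ContinuousOn (fun r' => (-(1 - ((r') - (s)) / 2 * Real.tanh (((r') - (s)) / 2)) * (Real.artanh ((r') / m) + Real.artanh ((s) / m)) - ((r') - (s)) / 2 * ((m / 2 * ((1 + (r') / m) * Real.log (1 + (r') / m) + (1 - (r') / m) * Real.log (1 - (r') / m))) - (m / 2 * ((1 + (s) / m) * Real.log (1 + (s) / m) + (1 - (s) / m) * Real.log (1 - (s) / m)))) + (𝔽 (r') + 𝔽 (s)))) (Set.uIcc (m * Real.tanh (-1 * K)) (m * Real.tanh K)) :=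
    hcont.mono hsub
  have hmem : ξ₀ ∈ Set.uIcc ((-(1 - ((m * Real.tanh (-1 * K)) - (s)) / 2 * Real.tanh (((m * Real.tanh (-1 * K)) - (s)) / 2)) * (Real.artanh ((m * Real.tanh (-1 * K)) / m) + Real.artanh ((s) / m)) - ((m * Real.tanh (-1 * K)) - (s)) / 2 * ((m / 2 * ((1 + (m * Real.tanh (-1 * K)) / m) * Real.log (1 + (m * Real.tanh (-1 * K)) / m) + (1 - (m * Real.tanh (-1 * K)) / m) * Real.log (1 - (m * Real.tanh (-1 * K)) / m))) - (m / 2 * ((1 + (s) / m) * Real.log (1 + (s) / m) + (1 - (s) / m) * Real.log (1 - (s) / m)))) + (𝔽 (m * Real.tanh (-1 * K)) + 𝔽 (s)))) ((-(1 - ((m * Real.tanh K) - (s)) / 2 * Real.tanh (((m * Real.tanh K) - (s)) / 2)) * (Real.artanh ((m * Real.tanh K) / m) + Real.artanh ((s) / m)) - ((m * Real.tanh K) - (s)) / 2 * ((m / 2 * ((1 + (m * Real.tanh K) / m) * Real.log (1 + (m * Real.tanh K) / m) + (1 - (m * Real.tanh K) / m) * Real.log (1 - (m * Real.tanh K) /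 m))) - (m / 2 * ((1 + (s) / m) * Real.log (1 + (s) / m) + (1 - (s) / m) * Real.log (1 - (s) / m)))) + (𝔽 (m * Real.tanh K) + 𝔽 (s)))) := by
    rw [Set.mem_uIcc]; right; exact ⟨vhi.le, vlo.le⟩
  obtain ⟨r, hrI, hrv⟩ := intermediate_value_uIcc hcont' hmem
  refine ⟨r, ⟨hsub hrI, hrv⟩, ?_⟩
  rintro r' ⟨hr'I, hr'v⟩
  exact (hanti.injOn.eq_iff hr'I (hsub hrI)).mp (hr'v.trans hrv.symm)

end Summit.NavierStokesRegularity.NavierStokesRegularity.Theorems.PoloidalWindowDoorPoloidalWindowRigidityZShockHodographOnto
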